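import Summits.ValiantsHypothesis.ValiantsHypothesis.Theorems.BarrierLeverChowStarveNoWitness

/-!
# Route BarrierLever — REFUTATION of item `ChowHitsThinRowPartitionMinors` (stmt-ValiantsHypothesis-20195)

Prover file (cell valiant-natproofs, rung V4, 𝒟-side; seat val-np-p2 gen 9).  **Closes item 20195
NEGATIVELY**: `not_ChowHitsThinRowPartitionMinors : ¬ Theses.BarrierLever.ChowHitsThinRowPartitionMinors`
(definition-free; the layout is built inline).

THE COUNTEREXAMPLE (memo HOME/val-np-p2/g9/REFUTATION-20195-valnp2-g9.md).  Given `h₀`, put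
`o = max 12 h₀` and `n = 2o + 1 ≥ h₀`.  Rows: ALL subsets of `Fin n` of size `≤ 2` (enumerated by
`Finset.equivFin`).  Columns: the same sets, except that every pair `{c, c'}` inside the STARVED block
`O = {o+1, …, 2o}` is replaced by the triple `{c − (o+1), c' − (o+1), o} ⊆ K = {0, …, o}`; the columns
are pairwise distinct, have size `≤ 3`, never contain two elements of `O`, and the triples avoid `O`.
By `…ChowStarveNoWitness.no_chow_witness` (the polynomial-identity form of the row-dependence
certificate of `…ChowStarveCertificate`, valid because `3n = 6o + 3 < C(o+1, 2)` for `o ≥ 12`) EVERY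
family of `n + n` polynomials of total degree `≤ 1` has vanishing partition minor on this layout —
contradicting the item at height `n ≥ h₀`.

Corollaries (separate files): items 20172 `ChowHitsPartitionMinors` and 20239
`ChowHitsReadOnceDeterminants` are false (landed arrows 20239 ⇒ 20172 ⇒ 20195).

WHAT THIS IS NOT: nothing on item 19717 `PartitionMinorsHitByVP` (VP witnesses are richer than products
of `n + n` affine forms; the dead layouts revive with ≈ `n²/2` forms), on crux
stmt-ValiantsHypothesis-14610, or on `VP` versus `VNP`.
-/

set_option linter.dupNamespace false

namespace Summit.ValiantsHypothesis.ValiantsHypothesis.Theorems.BarrierLever.ChowStarve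

open Finset MvPolynomial

/-- The count `3(2o+1) < C(o+1, 2)` for `o ≥ 12`. -/
theorem three_mul_lt_choose (o : ℕ) (ho : 12 ≤ o) :
    (2 * o + 1) + ((2 * o + 1) + (2 * o + 1)) < Nat.choose (o + 1) 2 := by
  rw [Nat.choose_two_right, Nat.add_sub_cancel]
  have h1 : 12 * o + 8 ≤ (o + 1) * o := by nlinarith
  have h2 : 6 * o + 4 ≤ (o + 1) * o / 2 := by
    rw [Nat.le_div_iff_mul_le (by norm_num)]
    omega
  omega

/-- **Item `ChowHitsThinRowPartitionMinors` (stmt-ValiantsHypothesis-20195) is FALSE.**  For every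
`h₀` there is a height `n ≥ h₀` (`n = 2 · max 12 h₀ + 1`) and an injective layout of rows of size
`≤ 2` against distinct columns on which the partition minor of EVERY product of `n + n` polynomials of
total degree `≤ 1` vanishes. -/
theorem not_ChowHitsThinRowPartitionMinors :
    ¬ Summit.ValiantsHypothesis.ValiantsHypothesis.Theses.BarrierLever.ChowHitsThinRowPartitionMinors := by
  classical
  unfold Summit.ValiantsHypothesis.ValiantsHypothesis.Theses.BarrierLever.ChowHitsThinRowPartitionMinors
  rintro ⟨h₀, H⟩
  -- the height
  set o : ℕ := max 12 h₀ with ho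
  have ho12 : 12 ≤ o := le_max_left _ _
  have hoh₀ : h₀ ≤ o := le_max_right _ _
  set n : ℕ := 2 * o + 1 with hn
  have hn₀ : h₀ ≤ n := by omega
  have hoo : o + o < n := by omega
  -- the rows: all sets of size `≤ 2`
  set 𝒯 : Finset (Finset (Fin n)) := Finset.univ.filter fun U => U.card ≤ 2 with h𝒯
  set r : ℕ := 𝒯.card with hr
  let e : 𝒯 ≃ Fin r := 𝒯.equivFin
  let u : Fin r → Finset (Fin n) := fun i => (e.symm i).1
  have hu_mem : ∀ i, (u i).card ≤ 2 := fun i => by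
    have h2 : ((e.symm i : 𝒯) : Finset (Fin n)) ∈ Finset.univ.filter (fun U : Finset (Fin n) => U.card ≤ 2) :=
      (e.symm i).2
    exact (Finset.mem_filter.mp h2).2
  have hu : Function.Injective u := fun i j hij =>
    e.symm.injective (Subtype.ext hij)
  have hcov : ∀ U : Finset (Fin n), U.card ≤ 2 → ∃ i, u i = U := fun U hU =>
    ⟨e ⟨U, Finset.mem_filter.mpr ⟨Finset.mem_univ _, hU⟩⟩, by
      simp only [u, Equiv.symm_apply_apply]⟩
  -- the columns: pairs inside `O` become triples inside `K`
  let σ : Fin n → Fin n := fun x => ⟨(x : ℕ) - (o + 1), by omega⟩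
  let oK : Fin n := ⟨o, by omega⟩
  let τ : Finset (Fin n) → Finset (Fin n) := fun U =>
    if U.card = 2 ∧ ∀ x ∈ U, o < (x : ℕ) then insert oK (U.image σ) else U
  let w : Fin r → Finset (Fin n) := fun i => τ (u i)
  -- elements of a modified column are `≤ o`
  have hτK : ∀ U : Finset (Fin n), ∀ x ∈ insert oK (U.image σ), (x : ℕ) ≤ o := by
    intro U x hx
    rcases Finset.mem_insert.mp hx with rfl | hx
    · exact le_rfl
    · obtain ⟨y, -, rfl⟩ := Finset.mem_image.mp hx
      show (y : ℕ) - (o + 1) ≤ o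
      have := y.is_lt
      omega
  have hσinj : ∀ U : Finset (Fin n), (∀ x ∈ U, o < (x : ℕ)) → Set.InjOn σ U := by
    intro U hU x hx y hy hxy
    have e1 := congrArg Fin.val hxy
    simp only [σ] at e1
    have := hU x hx
    have := hU y hy
    exact Fin.ext (by omega)
  have hcard3 : ∀ U : Finset (Fin n), U.card = 2 → (∀ x ∈ U, o < (x : ℕ)) →
      (insert oK (U.image σ)).card = 3 := by
    intro U hU2 hU
    rw [Finset.card_insert_of_notMem, Finset.card_image_of_injOn (hσinj U hU), hU2]
    intro hmem
    obtain ⟨y, hy, hyo⟩ := Finset.mem_image.mp hmem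
    have e1 := congrArg Fin.val hyo
    simp only [σ, oK] at e1
    have := hU y hy
    have := y.is_lt
    omega
  -- injectivity of the columns
  have hw : Function.Injective w := by
    intro i j hij
    simp only [w, τ] at hij
    by_cases hi : (u i).card = 2 ∧ ∀ x ∈ u i, o < (x : ℕ)
    · by_cases hj : (u j).card = 2 ∧ ∀ x ∈ u j, o < (x : ℕ)
      · rw [if_pos hi, if_pos hj] at hij
        apply hu
        -- strip the common vertex `o` and undo the shift
        have hoi : oK ∉ (u i).image σ := by
          intro hmem
          obtain ⟨y, hy, hyo⟩ := Finset.mem_image.mp hmem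
          have e1 := congrArg Fin.val hyo
          simp only [σ, oK] at e1
          have := hi.2 y hy; have := y.is_lt; omega
        have hoj : oK ∉ (u j).image σ := by
          intro hmem
          obtain ⟨y, hy, hyo⟩ := Finset.mem_image.mp hmem
          have e1 := congrArg Fin.val hyo
          simp only [σ, oK] at e1
          have := hj.2 y hy; have := y.is_lt; omega
        have himg : (u i).image σ = (u j).image σ := by
          have := congrArg (fun S => S.erase oK) hij
          simpa only [Finset.erase_insert hoi, Finset.erase_insert hoj] using this
        have hrec : ∀ U V : Finset (Fin n), (∀ x ∈ U, o < (x : ℕ)) → (∀ x ∈ V, o < (x : ℕ)) →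
            U.image σ = V.image σ → U ⊆ V := by
          intro U V hU hV hUV x hx
          have hmem : σ x ∈ V.image σ := hUV ▸ Finset.mem_image_of_mem σ hx
          obtain ⟨y, hy, hyx⟩ := Finset.mem_image.mp hmem
          have e1 := congrArg Fin.val hyx
          simp only [σ] at e1
          have := hU x hx
          have := hV y hy
          have hyx' : y = x := Fin.ext (by omega)
          rw [← hyx']
          exact hy
        exact Finset.Subset.antisymm (hrec _ _ hi.2 hj.2 himg) (hrec _ _ hj.2 hi.2 himg.symm)
      · rw [if_pos hi, if_neg hj] at hij
        exfalso
        have := hcard3 (u i) hi.1 hi.2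
        rw [hij] at this
        have := hu_mem j
        omega
    · by_cases hj : (u j).card = 2 ∧ ∀ x ∈ u j, o < (x : ℕ)
      · rw [if_neg hi, if_pos hj] at hij
        exfalso
        have := hcard3 (u j) hj.1 hj.2
        rw [← hij] at this
        have := hu_mem i
        omega
      · rw [if_neg hi, if_neg hj] at hij
        exact hu hij
  -- column properties
  have hw3 : ∀ j, (w j).card ≤ 3 := by
    intro j
    simp only [w, τ]
    by_cases hc : (u j).card = 2 ∧ ∀ x ∈ u j, o < (x : ℕ)
    · rw [if_pos hc, hcard3 (u j) hc.1 hc.2]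
    · rw [if_neg hc]
      exact (hu_mem j).trans (by norm_num)
  have hwO : ∀ j, ∀ c ∈ w j, ∀ c' ∈ w j, c ≠ c' → (c : ℕ) ≤ o ∨ (c' : ℕ) ≤ o := by
    intro j c hc c' hc' hne
    simp only [w, τ] at hc hc'
    by_cases hcond : (u j).card = 2 ∧ ∀ x ∈ u j, o < (x : ℕ)
    · rw [if_pos hcond] at hc
      exact Or.inl (hτK (u j) c hc)
    · rw [if_neg hcond] at hc hc'
      rcases Nat.lt_or_ge (u j).card 2 with hlt | hge
      · exact absurd (Finset.card_le_one.mp (by omega) c hc c' hc') hne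
      · have hcard2 : (u j).card = 2 := le_antisymm (hu_mem j) hge
        have hx : ∃ x ∈ u j, (x : ℕ) ≤ o := by
          by_contra hall
          push Not at hall
          exact hcond ⟨hcard2, hall⟩
        obtain ⟨x, hxU, hxo⟩ := hx
        obtain ⟨a, b, hab, hUab⟩ := Finset.card_eq_two.mp hcard2
        rw [hUab, Finset.mem_insert, Finset.mem_singleton] at hc hc' hxU
        rcases hc with rfl | rfl <;> rcases hc' with rfl | rfl
        · exact absurd rfl hne
        · rcases hxU with rfl | rfl
          · exact Or.inl hxo
          · exact Or.inr hxo
        · rcases hxU with rfl | rfl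
          · exact Or.inr hxo
          · exact Or.inl hxo
        · exact absurd rfl hne
  have hwK : ∀ j, (w j).card = 3 → ∀ e' ∈ w j, (e' : ℕ) ≤ o := by
    intro j h3 e' he'
    simp only [w, τ] at h3 he'
    by_cases hcond : (u j).card = 2 ∧ ∀ x ∈ u j, o < (x : ℕ)
    · rw [if_pos hcond] at he'
      exact hτK (u j) e' he'
    · rw [if_neg hcond] at h3
      have := hu_mem j
      omega
  -- the contradiction
  obtain ⟨ℓ, hℓ, hdet⟩ := H n hn₀ r u w hu hw hu_mem
  exact hdet (no_chow_witness o u w hu hcov hw3 hwO hwK hoo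
    (by rw [hn]; exact three_mul_lt_choose o ho12) ℓ hℓ)

end Summit.ValiantsHypothesis.ValiantsHypothesis.Theorems.BarrierLever.ChowStarve
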